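import Summits.PneNP.PneNP.Theses.RamseyAliens

/-!
# Route RamseyAliens — `Assembly` (stmt-PneNP-2271)

`Assembly := P_bool_eq → NP_bool_eq → P_subset_NP → PrinterOfPEqNP → NoExtremalPrinter → PneNP`. The route's deciding theorem
`Summit.PneNP.PneNP.Theses.RamseyAliens.closes : PrinterOfPEqNP → NoExtremalPrinter → PneNP` already discharges the three model
bridges internally (`P_bool_eq_holds`, `NP_bool_eq_holds`, `P_subset_NP_holds`), so the assembly is `closes` with the bridge
hypotheses dropped. This file imports only the route file (cone hygiene).
-/

set_option linter.dupNamespace false -- `Summit.PneNP.PneNP.…`: summit = sub-problem name (D-0017 single-conjunct layout)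

namespace Summit.PneNP.PneNP.Theorems

/-- **Assembly item of route RamseyAliens (stmt-PneNP-2271)**:
`P_bool_eq → NP_bool_eq → P_subset_NP → PrinterOfPEqNP → NoExtremalPrinter → PneNP`, by the route's deciding theorem
`RamseyAliens.closes` (the bridge hypotheses are not even needed: `closes` uses the proved bridges). [folklore] -/
theorem ramseyAliens_assembly_proof : Summit.PneNP.PneNP.Theses.RamseyAliens.Assembly := by
  unfold Summit.PneNP.PneNP.Theses.RamseyAliens.Assembly
  exact fun _ _ _ hP hX => Summit.PneNP.PneNP.Theses.RamseyAliens.closes hP hX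

end Summit.PneNP.PneNP.Theorems
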